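import Mathlib
import Literature.NumberTheory.Sieve.LinearCongruencePairs
import Literature.NumberTheory.Sieve.MoebiusCoprimeTailSums
import Literature.NumberTheory.Sieve.BombieriFriedlanderIwaniecPieces
import HarnessLib

/-!
# The singular-series main term of `Σ μ(d₀) log d₀ μ(d₁) log d₁ ρ(d₀,d₁)/(d₀d₁)` over a window of
# pairs of moduli of a pair of linear congruences is `≪ 1/log x`

Topic `Literature/NumberTheory/Sieve` (companion of `LinearCongruencePairs.lean` and
`MoebiusCoprimeTailSums.lean`).  For a pair of primitive linear forms `q₀n + a₀`, `q₁n + a₁`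
(`gcd(qᵢ,aᵢ) = 1`, resultant `Δ = q₁a₀ − q₀a₁ ≠ 0`) the local count of the pair of congruences
`d₀ ∣ q₀n + a₀`, `d₁ ∣ q₁n + a₁` is

  `ρ(d) = #{n mod d₀d₁ : d₀ ∣ q₀n + a₀, d₁ ∣ q₁n + a₁}
        = [gcd(d₀,q₀)=1][gcd(d₁,q₁)=1][gcd(d₀,d₁) ∣ Δ] · gcd(d₀,d₁)`       (`card_range_filter_pair`),

and the MAIN-TERM COEFFICIENT of a divisor-window sum with Möbius-log weights,

  `M(x) = Σ_{d₀ ≤ B₀, d₁ ≤ B₁} [x^{1−η} < d₀d₁ ≤ x^{1+θ}] [x^σ < min dᵢ] μ(d₀) log d₀ μ(d₁) log d₁ · ρ(d)/(d₀d₁)`,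

satisfies `|M(x)| ≪_{q,Δ,σ} 1/log x` for EVERY `σ > 0`, all real `θ, η` and `B₀ ≤ x²`
(`abs_doubleSum_le`, with an explicit constant).  Everything is PROVED:

* `inner_eq` — for fixed `d₀` the `d₁`-sum, grouped by `e = gcd(d₀,d₁) ∣ gcd(d₀,Δ)`, `d₁ = e m`, is
  `Σ_e [gcd(e,q₁)=1] μ(e) Σ_{m ∈ (A/e, W/e], gcd(m, d₀q₁)=1} μ(m) (log e + log m)/m`;
* `abs_inner_le` — the tails `Σ_{(m,k)=1} μ(m)/m`, `Σ μ(m) log m/m` over `m > A/e` are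
  `≪ 4^{ω(k)} (log A)^{-6}` (`MoebiusCoprimeTail.*`, Siegel–Walfisz strength);
* `abs_doubleSum_le` — `Σ_{d₀ ≤ x²} log d₀ · 4^{ω(d₀)}/d₀ ≪ (log x)^5`, whence `|M(x)| ≪ 1/log x`.

## References

* H. Iwaniec, E. Kowalski, *Analytic Number Theory*, AMS Colloquium Publ. 53 (2004), §5.9
  (Siegel–Walfisz for `μ`) and Ch. 6 (main terms of sieve sums). [folklore]
-/

open scoped BigOperators ArithmeticFunction.Moebius
open Finset

namespace Literature.NumberTheory.Sieve.LinearPairMoebius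

open Literature.NumberTheory.Sieve.LinearCongruencePair


/-! ### Sums over `Fin 2 → ℕ` boxes as double sums -/

/-- A sum over a box `∏_{i : Fin 2} sᵢ` is a double sum. [folklore] -/
theorem sum_piFinset_two {M : Type*} [AddCommMonoid M] (s : Fin 2 → Finset ℕ)
    (F : (Fin 2 → ℕ) → M) :
    ∑ d ∈ Fintype.piFinset s, F d = ∑ a ∈ s 0, ∑ b ∈ s 1, F ![a, b] := by
  rw [← Finset.sum_product']
  refine Finset.sum_nbij' (fun d => (d 0, d 1)) (fun p => ![p.1, p.2]) ?_ ?_ ?_ ?_ ?_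
  · intro d hd
    rw [Fintype.mem_piFinset] at hd
    rw [Finset.mem_product]
    exact ⟨hd 0, hd 1⟩
  · intro p hp
    rw [Finset.mem_product] at hp
    rw [Fintype.mem_piFinset]
    intro i
    fin_cases i
    · simpa using hp.1
    · simpa using hp.2
  · intro d _
    ext i
    fin_cases i <;> simp
  · intro p _
    simp
  · intro d _
    congr 1
    ext i
    fin_cases i <;> simp

/-! ### The local count `ρ(d)` -/

/-- `#{n < g L : n ≡ ν (mod L)} = g` for `L ≥ 1`. [folklore] -/
theorem card_range_mul_filter_modEq {L : ℕ} (hL : 0 < L) (g ν : ℕ) :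
    #((Finset.range (g * L)).filter fun n : ℕ => n ≡ ν [MOD L]) = g := by
  rw [← Nat.count_eq_card_filter_range, Nat.count_modEq_card _ hL]
  rw [Nat.mul_mod_left, Nat.mul_div_cancel _ hL]
  simp

variable {q₀ q₁ : ℕ} {a₀ a₁ : ℤ}

/-- **The local count.**  For `qᵢ ≥ 1`, `gcd(qᵢ,aᵢ) = 1`, `dᵢ ≥ 1`:
`#{n < d₀d₁ : d₀ ∣ q₀n+a₀, d₁ ∣ q₁n+a₁} = gcd(d₀,d₁)` if `gcd(d₀,q₀) = gcd(d₁,q₁) = 1` and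
`gcd(d₀,d₁) ∣ Δ = q₁a₀ − q₀a₁`, and `= 0` otherwise. [folklore] -/
theorem card_range_filter_pair (hc₀ : IsCoprime (q₀ : ℤ) a₀) (hc₁ : IsCoprime (q₁ : ℤ) a₁)
    {d₀ d₁ : ℕ} (hd₀ : 0 < d₀) (hd₁ : 0 < d₁) :
    (#((Finset.range (d₀ * d₁)).filter fun n : ℕ =>
        (d₀ : ℤ) ∣ (q₀ : ℤ) * n + a₀ ∧ (d₁ : ℤ) ∣ (q₁ : ℤ) * n + a₁) : ℝ) =
      if Nat.Coprime d₀ q₀ ∧ Nat.Coprime d₁ q₁ ∧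
          ((Nat.gcd d₀ d₁ : ℕ) : ℤ) ∣ (q₁ : ℤ) * a₀ - (q₀ : ℤ) * a₁
      then (Nat.gcd d₀ d₁ : ℝ) else 0 := by
  have hsolv := pair_solvable_iff (d₀ := d₀) (d₁ := d₁) hc₀ hc₁
  split_ifs with hcrit
  · -- solvable: one class mod `L`, `d₀d₁ = gcd · L`
    have hsol : ∃ n : ℤ, (d₀ : ℤ) ∣ (q₀ : ℤ) * n + a₀ ∧ (d₁ : ℤ) ∣ (q₁ : ℤ) * n + a₁ :=
      hsolv.2 ⟨Nat.isCoprime_iff_coprime.2 hcrit.1, Nat.isCoprime_iff_coprime.2 hcrit.2.1,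
        hcrit.2.2⟩
    obtain ⟨ν, -, hν₀, hν₁⟩ := exists_nat_sol_lt_lcm hd₀ hd₁ hsol
    have hL : 0 < Nat.lcm d₀ d₁ := Nat.lcm_pos hd₀ hd₁
    have hfilter : ((Finset.range (d₀ * d₁)).filter fun n : ℕ =>
        (d₀ : ℤ) ∣ (q₀ : ℤ) * n + a₀ ∧ (d₁ : ℤ) ∣ (q₁ : ℤ) * n + a₁) =
        (Finset.range (Nat.gcd d₀ d₁ * Nat.lcm d₀ d₁)).filter
          fun n : ℕ => n ≡ ν [MOD Nat.lcm d₀ d₁] := by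
      rw [Nat.gcd_mul_lcm]
      refine Finset.filter_congr fun n _ => ?_
      rw [pair_dvd_iff_modEq hc₀ hc₁ hν₀ hν₁, Int.natCast_modEq_iff]
    rw [hfilter, card_range_mul_filter_modEq hL]
  · -- unsolvable
    have hns : ¬ ∃ n : ℤ, (d₀ : ℤ) ∣ (q₀ : ℤ) * n + a₀ ∧ (d₁ : ℤ) ∣ (q₁ : ℤ) * n + a₁ := by
      intro h
      obtain ⟨h0, h1, h2⟩ := hsolv.1 h
      exact hcrit ⟨Nat.isCoprime_iff_coprime.1 h0, Nat.isCoprime_iff_coprime.1 h1, h2⟩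
    rw [Nat.cast_eq_zero, Finset.card_eq_zero, Finset.filter_eq_empty_iff]
    intro n _ hn
    exact hns ⟨n, hn⟩

/-! ### The inner sum over `d₁` for fixed `d₀`: grouping by `e = gcd(d₀, d₁)` -/

/-- `μ(e m) (log e + log m)/m`-bookkeeping: for `e ≥ 1`, `m ≥ 1`,
`μ(em) · log(em) · e/(em) = [gcd(e,m)=1] μ(e) μ(m) (log e + log m)/m`. [folklore] -/
theorem moebius_mul_term {e m : ℕ} (he : 0 < e) (hm : 0 < m) :
    (μ (e * m) : ℝ) * Real.log ((e * m : ℕ) : ℝ) * ((e : ℝ) / ((e * m : ℕ) : ℝ)) =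
      if Nat.Coprime e m then (μ e : ℝ) * (μ m : ℝ) * (Real.log e + Real.log m) / m else 0 := by
  have he0 : (e : ℝ) ≠ 0 := by exact_mod_cast he.ne'
  have hm0 : (m : ℝ) ≠ 0 := by exact_mod_cast hm.ne'
  split_ifs with hcop
  · rw [ArithmeticFunction.isMultiplicative_moebius.map_mul_of_coprime hcop]
    push_cast
    rw [Real.log_mul he0 hm0]
    field_simp
  · have hsq : ¬ Squarefree (e * m) := by
      intro hsf
      exact hcop ((Nat.squarefree_mul_iff.1 hsf).1)
    rw [ArithmeticFunction.moebius_eq_zero_of_not_squarefree hsq]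
    simp

/-- For `e ∣ d₀`, `e ≥ 1`: `gcd(d₀, e m) = e ↔ gcd(d₀/e, m) = 1`. [folklore] -/
theorem gcd_mul_eq_iff {d₀ e m : ℕ} (he : 0 < e) (hed₀ : e ∣ d₀) :
    Nat.gcd d₀ (e * m) = e ↔ Nat.Coprime (d₀ / e) m := by
  obtain ⟨d, rfl⟩ := hed₀
  rw [Nat.gcd_mul_left, Nat.mul_div_cancel_left _ he, Nat.Coprime]
  constructor
  · intro h
    have : e * Nat.gcd d m = e * 1 := by rw [mul_one]; exact h
    exact Nat.eq_of_mul_eq_mul_left he this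
  · intro h; rw [h, mul_one]

/-- For `e ∣ d₀`: `gcd(d₀/e, m) = 1 ∧ gcd(e, m) = 1 ↔ gcd(d₀, m) = 1`. [folklore] -/
theorem coprime_div_and_iff {d₀ e m : ℕ} (he : 0 < e) (hed₀ : e ∣ d₀) :
    (Nat.Coprime (d₀ / e) m ∧ Nat.Coprime e m) ↔ Nat.Coprime d₀ m := by
  obtain ⟨d, rfl⟩ := hed₀
  rw [Nat.mul_div_cancel_left _ he]
  constructor
  · rintro ⟨h1, h2⟩
    exact Nat.Coprime.mul_left h2 h1
  · intro h
    exact ⟨Nat.Coprime.coprime_mul_left (by rwa [mul_comm] at h), Nat.Coprime.coprime_mul_right h⟩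

/-- Membership of a multiple `e m` in `(a, b]`: `a < e m ≤ b ↔ a/e < m ≤ b/e` (natural division,
`e ≥ 1`). [folklore] -/
theorem mul_mem_Ioc_iff {e a b m : ℕ} (he : 0 < e) :
    e * m ∈ Finset.Ioc a b ↔ m ∈ Finset.Ioc (a / e) (b / e) := by
  rw [Finset.mem_Ioc, Finset.mem_Ioc, Nat.div_lt_iff_lt_mul he, Nat.le_div_iff_mul_le he,
    mul_comm m e]

/-- **The inner sum, grouped by `e = gcd(d₀, d₁)`.**  For `d₀ ≥ 1`, `q₁ ≥ 1`, an integer `Δ` and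
`a ≤ b`:
`Σ_{a < d₁ ≤ b} [gcd(d₁,q₁)=1] [gcd(d₀,d₁) ∣ Δ] μ(d₁) log d₁ · gcd(d₀,d₁)/d₁
   = Σ_{e ∣ gcd(d₀, |Δ|)} [gcd(e,q₁)=1] μ(e) Σ_{a/e < m ≤ b/e, gcd(m, d₀q₁)=1} μ(m)(log e + log m)/m`
(`Δ ≠ 0`). [folklore] -/
theorem inner_eq (d₀ q₁ : ℕ) {Δ : ℤ} (hΔ : Δ ≠ 0) (a b : ℕ) :
    ∑ d₁ ∈ Finset.Ioc a b,
        (if Nat.Coprime d₁ q₁ ∧ ((Nat.gcd d₀ d₁ : ℕ) : ℤ) ∣ Δ then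
          (μ d₁ : ℝ) * Real.log d₁ * ((Nat.gcd d₀ d₁ : ℝ) / d₁) else 0) =
      ∑ e ∈ (Nat.gcd d₀ Δ.natAbs).divisors,
        if Nat.Coprime e q₁ then
          (μ e : ℝ) * ∑ m ∈ (Finset.Ioc (a / e) (b / e)).filter (fun m : ℕ => m.Coprime (d₀ * q₁)),
            (μ m : ℝ) * (Real.log e + Real.log m) / m
        else 0 := by
  classical
  have hD : 0 < Δ.natAbs := Int.natAbs_pos.2 hΔ
  -- insert `1 = Σ_{e ∣ gcd(d₀,|Δ|)} [gcd(d₀,d₁) = e]` on the support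
  have hLHS : ∀ d₁ ∈ Finset.Ioc a b,
      (if Nat.Coprime d₁ q₁ ∧ ((Nat.gcd d₀ d₁ : ℕ) : ℤ) ∣ Δ then
          (μ d₁ : ℝ) * Real.log d₁ * ((Nat.gcd d₀ d₁ : ℝ) / d₁) else 0) =
        ∑ e ∈ (Nat.gcd d₀ Δ.natAbs).divisors,
          if Nat.gcd d₀ d₁ = e ∧ Nat.Coprime d₁ q₁ then
            (μ d₁ : ℝ) * Real.log d₁ * ((e : ℝ) / d₁) else 0 := by
    intro d₁ _
    by_cases h : Nat.Coprime d₁ q₁ ∧ ((Nat.gcd d₀ d₁ : ℕ) : ℤ) ∣ Δ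
    · rw [if_pos h]
      have hmem : Nat.gcd d₀ d₁ ∈ (Nat.gcd d₀ Δ.natAbs).divisors := by
        rw [Nat.mem_divisors]
        refine ⟨Nat.dvd_gcd (Nat.gcd_dvd_left _ _) ?_, (Nat.gcd_pos_of_pos_right _ hD).ne'⟩
        exact Int.natCast_dvd.1 h.2
      rw [Finset.sum_eq_single_of_mem _ hmem]
      · rw [if_pos ⟨rfl, h.1⟩]
      · intro e _ hne
        rw [if_neg]
        rintro ⟨h1, -⟩
        exact hne h1.symm
    · rw [if_neg h]
      symm
      refine Finset.sum_eq_zero fun e he => ?_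
      rw [if_neg]
      rintro ⟨h1, h2⟩
      apply h
      refine ⟨h2, ?_⟩
      rw [h1]
      have := Nat.dvd_trans (Nat.dvd_of_mem_divisors he) (Nat.gcd_dvd_right _ _)
      exact Int.natCast_dvd.2 this
  rw [Finset.sum_congr rfl hLHS, Finset.sum_comm]
  refine Finset.sum_congr rfl fun e he => ?_
  have he0 : 0 < e := Nat.pos_of_mem_divisors he
  have hed₀ : e ∣ d₀ := Nat.dvd_trans (Nat.dvd_of_mem_divisors he) (Nat.gcd_dvd_left _ _)
  -- restrict to `e ∣ d₁`
  have hsupp : ∑ d₁ ∈ Finset.Ioc a b,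
      (if Nat.gcd d₀ d₁ = e ∧ Nat.Coprime d₁ q₁ then
        (μ d₁ : ℝ) * Real.log d₁ * ((e : ℝ) / d₁) else 0) =
      ∑ d₁ ∈ (Finset.Ioc a b).filter (fun d₁ : ℕ => e ∣ d₁),
        (if Nat.gcd d₀ d₁ = e ∧ Nat.Coprime d₁ q₁ then
          (μ d₁ : ℝ) * Real.log d₁ * ((e : ℝ) / d₁) else 0) := by
    rw [Finset.sum_filter]
    refine Finset.sum_congr rfl fun d₁ _ => ?_
    by_cases hdiv : e ∣ d₁
    · rw [if_pos hdiv]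
    · rw [if_neg hdiv, if_neg]
      rintro ⟨h1, -⟩
      exact hdiv (h1 ▸ Nat.gcd_dvd_right d₀ d₁)
  -- reindex `d₁ = e m`
  have himage : (Finset.Ioc a b).filter (fun d₁ : ℕ => e ∣ d₁) =
      (Finset.Ioc (a / e) (b / e)).image (fun m => e * m) := by
    ext d₁
    rw [Finset.mem_filter, Finset.mem_image]
    constructor
    · rintro ⟨hd₁, m, rfl⟩
      exact ⟨m, (mul_mem_Ioc_iff he0).1 hd₁, rfl⟩
    · rintro ⟨m, hm, rfl⟩
      exact ⟨(mul_mem_Ioc_iff he0).2 hm, Dvd.intro m rfl⟩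
  have hinj : Set.InjOn (fun m => e * m) ↑(Finset.Ioc (a / e) (b / e)) :=
    fun m _ m' _ h => Nat.eq_of_mul_eq_mul_left he0 h
  rw [hsupp, himage, Finset.sum_image hinj]
  -- evaluate the summand at `d₁ = e m`
  have hterm : ∀ m ∈ Finset.Ioc (a / e) (b / e),
      (if Nat.gcd d₀ (e * m) = e ∧ Nat.Coprime (e * m) q₁ then
        (μ (e * m) : ℝ) * Real.log ((e * m : ℕ) : ℝ) * ((e : ℝ) / ((e * m : ℕ) : ℝ)) else 0) =
      if Nat.Coprime e q₁ ∧ m.Coprime (d₀ * q₁) then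
        (μ e : ℝ) * ((μ m : ℝ) * (Real.log e + Real.log m) / m) else 0 := by
    intro m hm
    have hm0 : 0 < m := lt_of_le_of_lt (Nat.zero_le _) (Finset.mem_Ioc.1 hm).1
    rw [moebius_mul_term he0 hm0]
    have hiff : (Nat.gcd d₀ (e * m) = e ∧ Nat.Coprime (e * m) q₁) ↔
        (Nat.Coprime (d₀ / e) m ∧ Nat.Coprime e q₁ ∧ Nat.Coprime m q₁) := by
      rw [gcd_mul_eq_iff he0 hed₀, Nat.coprime_mul_iff_left]
    by_cases hA : Nat.Coprime (d₀ / e) m ∧ Nat.Coprime e q₁ ∧ Nat.Coprime m q₁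
    · rw [if_pos (hiff.2 hA)]
      by_cases hB : Nat.Coprime e m
      · rw [if_pos hB, if_pos]
        · ring
        · refine ⟨hA.2.1, Nat.coprime_mul_iff_right.2 ⟨?_, hA.2.2⟩⟩
          exact Nat.Coprime.symm ((coprime_div_and_iff he0 hed₀).1 ⟨hA.1, hB⟩)
      · rw [if_neg hB, if_neg]
        rintro ⟨-, h2⟩
        have hd₀m : Nat.Coprime d₀ m := (Nat.coprime_mul_iff_right.1 h2).1.symm
        exact hB ((coprime_div_and_iff he0 hed₀).2 hd₀m).2
    · rw [if_neg (fun h => hA (hiff.1 h))]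
      split_ifs with hB
      · exfalso
        apply hA
        have hd₀m : Nat.Coprime d₀ m := (Nat.coprime_mul_iff_right.1 hB.2).1.symm
        exact ⟨((coprime_div_and_iff he0 hed₀).2 hd₀m).1, hB.1,
          (Nat.coprime_mul_iff_right.1 hB.2).2⟩
      · rfl
  rw [Finset.sum_congr rfl hterm]
  by_cases hcop : Nat.Coprime e q₁
  · rw [if_pos hcop, Finset.mul_sum, Finset.sum_filter]
    refine Finset.sum_congr rfl fun m _ => ?_
    by_cases hm : m.Coprime (d₀ * q₁)
    · rw [if_pos ⟨hcop, hm⟩, if_pos hm]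
    · rw [if_neg (fun h => hm h.2), if_neg hm]
  · rw [if_neg hcop]
    refine Finset.sum_eq_zero fun m _ => ?_
    rw [if_neg (fun h => hcop h.1)]

/-! ### The inner sum is small: Siegel–Walfisz-strength tails -/

/-- **The inner sum is small.**  Let `q₁ ≥ 1`, `Δ ≠ 0`, `D = |Δ|`, and let `C₁, C₂` be constants of
`MoebiusCoprimeTail.abs_sum_Ioc_coprime_moebius_div_le` / `…_mul_log_div_le` with `B = 6`.  Then for
every `d₀ ≥ 1`, every real `A ≥ 2D` and every natural `b`,
`|Σ_{⌊A⌋ < d₁ ≤ b} [gcd(d₁,q₁)=1][gcd(d₀,d₁) ∣ Δ] μ(d₁) log d₁ gcd(d₀,d₁)/d₁|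
   ≤ τ(D) (C₁ log D + C₂) 4^{ω(q₁)} 4^{ω(d₀)} (log(A/D))^{-6}`. [folklore] -/
theorem abs_inner_le {q₁ : ℕ} (hq₁ : 0 < q₁) {Δ : ℤ} (hΔ : Δ ≠ 0) {C₁ C₂ : ℝ} (hC₁0 : 0 ≤ C₁)
    (hC₂0 : 0 ≤ C₂)
    (hC₁ : ∀ q : ℕ, q ≠ 0 → ∀ A W : ℝ, 2 ≤ A → A ≤ W →
      |∑ n ∈ (Ioc ⌊A⌋₊ ⌊W⌋₊).filter (fun n : ℕ => n.Coprime q), (μ n : ℝ) / n| ≤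
        C₁ * (4 : ℝ) ^ q.primeFactors.card / Real.log A ^ (6 : ℝ))
    (hC₂ : ∀ q : ℕ, q ≠ 0 → ∀ A W : ℝ, 2 ≤ A → A ≤ W →
      |∑ n ∈ (Ioc ⌊A⌋₊ ⌊W⌋₊).filter (fun n : ℕ => n.Coprime q), (μ n : ℝ) * Real.log n / n| ≤
        C₂ * (4 : ℝ) ^ q.primeFactors.card / Real.log A ^ (6 : ℝ))
    {d₀ : ℕ} (hd₀ : 0 < d₀) {A : ℝ} (hA : 2 * (Δ.natAbs : ℝ) ≤ A) (b : ℕ) :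
    |∑ d₁ ∈ Finset.Ioc ⌊A⌋₊ b,
        (if Nat.Coprime d₁ q₁ ∧ ((Nat.gcd d₀ d₁ : ℕ) : ℤ) ∣ Δ then
          (μ d₁ : ℝ) * Real.log d₁ * ((Nat.gcd d₀ d₁ : ℝ) / d₁) else 0)| ≤
      (Δ.natAbs.divisors.card : ℝ) * (C₁ * Real.log Δ.natAbs + C₂) *
        (4 : ℝ) ^ q₁.primeFactors.card * (4 : ℝ) ^ d₀.primeFactors.card /
          Real.log (A / Δ.natAbs) ^ (6 : ℝ) := by
  set D : ℕ := Δ.natAbs with hDdef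
  have hD : 0 < D := Int.natAbs_pos.2 hΔ
  have hD1 : (1 : ℝ) ≤ D := by exact_mod_cast hD
  have hDpos : (0 : ℝ) < D := by positivity
  have hA2 : (2 : ℝ) ≤ A / D := by rw [le_div_iff₀ hDpos]; linarith
  have hlogAD : 0 < Real.log (A / D) := Real.log_pos (by linarith)
  have hlogD : 0 ≤ Real.log D := Real.log_nonneg hD1
  have hA0 : 0 ≤ A := by nlinarith
  -- the grouped form
  rw [show b = ⌊((b : ℕ) : ℝ)⌋₊ by rw [Nat.floor_natCast], inner_eq d₀ q₁ hΔ]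
  rw [Nat.floor_natCast]
  -- each `e`-term
  set RHS1 : ℝ := (C₁ * Real.log D + C₂) * (4 : ℝ) ^ q₁.primeFactors.card *
    (4 : ℝ) ^ d₀.primeFactors.card / Real.log (A / D) ^ (6 : ℝ) with hRHS1
  have hRHS1_nonneg : 0 ≤ RHS1 := by rw [hRHS1]; positivity
  have hterm : ∀ e ∈ (Nat.gcd d₀ D).divisors,
      |(if Nat.Coprime e q₁ then
          (μ e : ℝ) * ∑ m ∈ (Finset.Ioc (⌊A⌋₊ / e) (b / e)).filter (fun m : ℕ => m.Coprime (d₀ * q₁)),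
            (μ m : ℝ) * (Real.log e + Real.log m) / m
        else 0)| ≤ RHS1 := by
    intro e he
    have he0 : 0 < e := Nat.pos_of_mem_divisors he
    have heD : e ∣ D := Nat.dvd_trans (Nat.dvd_of_mem_divisors he) (Nat.gcd_dvd_right _ _)
    have heDle : (e : ℝ) ≤ D := by exact_mod_cast Nat.le_of_dvd hD heD
    have he1 : (1 : ℝ) ≤ e := by exact_mod_cast he0
    have hepos : (0 : ℝ) < e := by positivity
    split_ifs with hcop
    swap
    · rw [abs_zero]; exact hRHS1_nonneg
    -- the ranges as floors of reals
    have hfloorA : ⌊A⌋₊ / e = ⌊A / e⌋₊ := (Nat.floor_div_natCast A e).symm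
    have hfloorb : b / e = ⌊(b : ℝ) / e⌋₊ := by
      rw [Nat.floor_div_natCast, Nat.floor_natCast]
    rw [hfloorA, hfloorb]
    have hAe2 : 2 ≤ A / e := by
      rw [le_div_iff₀ hepos]
      calc 2 * (e : ℝ) ≤ 2 * D := by linarith
        _ ≤ A := hA
    have hlogAe : Real.log (A / D) ≤ Real.log (A / e) := by
      refine Real.log_le_log (by linarith) ?_
      exact div_le_div_of_nonneg_left hA0 hepos heDle
    have hq : d₀ * q₁ ≠ 0 := Nat.mul_ne_zero hd₀.ne' hq₁.ne'
    -- split `log e + log m`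
    have hsplit : ∑ m ∈ (Finset.Ioc ⌊A / e⌋₊ ⌊(b : ℝ) / e⌋₊).filter (fun m : ℕ => m.Coprime (d₀ * q₁)),
        (μ m : ℝ) * (Real.log e + Real.log m) / m =
        Real.log e * ∑ m ∈ (Finset.Ioc ⌊A / e⌋₊ ⌊(b : ℝ) / e⌋₊).filter
            (fun m : ℕ => m.Coprime (d₀ * q₁)), (μ m : ℝ) / m +
          ∑ m ∈ (Finset.Ioc ⌊A / e⌋₊ ⌊(b : ℝ) / e⌋₊).filter (fun m : ℕ => m.Coprime (d₀ * q₁)),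
            (μ m : ℝ) * Real.log m / m := by
      rw [Finset.mul_sum, ← Finset.sum_add_distrib]
      refine Finset.sum_congr rfl fun m _ => ?_
      ring
    rw [hsplit, abs_mul]
    have hμe : |(μ e : ℝ)| ≤ 1 := by exact_mod_cast ArithmeticFunction.abs_moebius_le_one
    -- bounds on the two tails (empty range if `b/e < A/e`)
    have h4 := BFI.four_pow_card_primeFactors_mul_le d₀ q₁
    have hpow6 : Real.log (A / D) ^ (6 : ℝ) ≤ Real.log (A / e) ^ (6 : ℝ) :=
      Real.rpow_le_rpow hlogAD.le hlogAe (by norm_num)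
    have hpow6pos : 0 < Real.log (A / D) ^ (6 : ℝ) := Real.rpow_pos_of_pos hlogAD _
    have hS₀ : |∑ m ∈ (Finset.Ioc ⌊A / e⌋₊ ⌊(b : ℝ) / e⌋₊).filter (fun m : ℕ => m.Coprime (d₀ * q₁)),
        (μ m : ℝ) / m| ≤ C₁ * ((4 : ℝ) ^ d₀.primeFactors.card * (4 : ℝ) ^ q₁.primeFactors.card) /
          Real.log (A / D) ^ (6 : ℝ) := by
      rcases le_or_gt (A / e) ((b : ℝ) / e) with hle | hgt
      · refine (hC₁ _ hq _ _ hAe2 hle).trans ?_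
        gcongr
      · have hempty : Finset.Ioc ⌊A / e⌋₊ ⌊(b : ℝ) / e⌋₊ = ∅ := by
          refine Finset.Ioc_eq_empty (not_lt.2 (Nat.floor_le_floor hgt.le))
        rw [hempty, Finset.filter_empty, Finset.sum_empty, abs_zero]
        positivity
    have hS₁ : |∑ m ∈ (Finset.Ioc ⌊A / e⌋₊ ⌊(b : ℝ) / e⌋₊).filter (fun m : ℕ => m.Coprime (d₀ * q₁)),
        (μ m : ℝ) * Real.log m / m| ≤ C₂ * ((4 : ℝ) ^ d₀.primeFactors.card * (4 : ℝ) ^ q₁.primeFactors.card) /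
          Real.log (A / D) ^ (6 : ℝ) := by
      rcases le_or_gt (A / e) ((b : ℝ) / e) with hle | hgt
      · refine (hC₂ _ hq _ _ hAe2 hle).trans ?_
        gcongr
      · have hempty : Finset.Ioc ⌊A / e⌋₊ ⌊(b : ℝ) / e⌋₊ = ∅ := by
          refine Finset.Ioc_eq_empty (not_lt.2 (Nat.floor_le_floor hgt.le))
        rw [hempty, Finset.filter_empty, Finset.sum_empty, abs_zero]
        positivity
    have hloge : Real.log e ≤ Real.log D := Real.log_le_log hepos heDle
    have hloge0 : 0 ≤ Real.log e := Real.log_nonneg he1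
    set T₀ := ∑ m ∈ (Finset.Ioc ⌊A / e⌋₊ ⌊(b : ℝ) / e⌋₊).filter (fun m : ℕ => m.Coprime (d₀ * q₁)),
        (μ m : ℝ) / m
    set T₁ := ∑ m ∈ (Finset.Ioc ⌊A / e⌋₊ ⌊(b : ℝ) / e⌋₊).filter (fun m : ℕ => m.Coprime (d₀ * q₁)),
        (μ m : ℝ) * Real.log m / m
    set Φ : ℝ := (4 : ℝ) ^ d₀.primeFactors.card * (4 : ℝ) ^ q₁.primeFactors.card /
      Real.log (A / D) ^ (6 : ℝ) with hΦ
    have hΦ0 : 0 ≤ Φ := by positivity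
    calc |(μ e : ℝ)| * |Real.log e * T₀ + T₁| ≤ 1 * (Real.log e * |T₀| + |T₁|) := by
          refine mul_le_mul hμe ?_ (abs_nonneg _) zero_le_one
          calc |Real.log e * T₀ + T₁| ≤ |Real.log e * T₀| + |T₁| := abs_add_le _ _
            _ = Real.log e * |T₀| + |T₁| := by rw [abs_mul, abs_of_nonneg hloge0]
      _ ≤ Real.log D * (C₁ * Φ) + C₂ * Φ := by
          rw [one_mul]
          refine add_le_add (mul_le_mul hloge (by rw [hΦ, ← mul_div_assoc]; exact hS₀)
            (abs_nonneg _) hlogD) (by rw [hΦ, ← mul_div_assoc]; exact hS₁)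
      _ = RHS1 := by rw [hRHS1, hΦ]; ring
  -- sum over `e`
  calc |∑ e ∈ (Nat.gcd d₀ D).divisors, _| ≤ ∑ e ∈ (Nat.gcd d₀ D).divisors,
        |(if Nat.Coprime e q₁ then
          (μ e : ℝ) * ∑ m ∈ (Finset.Ioc (⌊A⌋₊ / e) (b / e)).filter (fun m : ℕ => m.Coprime (d₀ * q₁)),
            (μ m : ℝ) * (Real.log e + Real.log m) / m
        else 0)| := Finset.abs_sum_le_sum_abs _ _
    _ ≤ ∑ _e ∈ (Nat.gcd d₀ D).divisors, RHS1 := Finset.sum_le_sum hterm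
    _ = ((Nat.gcd d₀ D).divisors.card : ℝ) * RHS1 := by rw [Finset.sum_const, nsmul_eq_mul]
    _ ≤ (D.divisors.card : ℝ) * RHS1 := by
        refine mul_le_mul_of_nonneg_right ?_ hRHS1_nonneg
        exact_mod_cast Finset.card_le_card (Nat.divisors_subset_of_dvd hD.ne' (Nat.gcd_dvd_right _ _))
    _ = _ := by rw [hRHS1]; ring


/-! ### The `d₁`-range cut out by the window for fixed `d₀` -/

/-- For fixed `d₀ > x^σ` the window conditions on `d₁ ∈ [1, B₁]` cut out the interval
`(⌊max(x^σ, x^{1−η}/d₀)⌋, min(⌊x^{1+θ}/d₀⌋, B₁)]`. [folklore] -/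
theorem filter_window_eq {x σ θ η : ℝ} (hxσ : 0 ≤ x ^ σ) (hx1 : 0 ≤ x ^ (1 + θ)) {d₀ : ℕ}
    (hd₀ : x ^ σ < d₀) (B₁ : ℕ) :
    (Finset.Icc 1 B₁).filter (fun d₁ : ℕ => x ^ (1 - η) < (d₀ : ℝ) * d₁ ∧ (d₀ : ℝ) * d₁ ≤ x ^ (1 + θ) ∧
        x ^ σ < (d₀ : ℝ) ∧ x ^ σ < (d₁ : ℝ)) =
      Finset.Ioc ⌊max (x ^ σ) (x ^ (1 - η) / d₀)⌋₊ (min ⌊x ^ (1 + θ) / d₀⌋₊ B₁) := by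
  have hd₀pos : (0 : ℝ) < d₀ := lt_of_le_of_lt hxσ hd₀
  have hA0 : 0 ≤ max (x ^ σ) (x ^ (1 - η) / d₀) := le_max_of_le_left hxσ
  ext d₁
  rw [Finset.mem_filter, Finset.mem_Icc, Finset.mem_Ioc, Nat.floor_lt hA0, max_lt_iff,
    le_min_iff, Nat.le_floor_iff (div_nonneg hx1 hd₀pos.le), div_lt_iff₀ hd₀pos,
    le_div_iff₀ hd₀pos, mul_comm (d₁ : ℝ) (d₀ : ℝ)]
  constructor
  · rintro ⟨⟨-, h2⟩, h3, h4, -, h6⟩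
    exact ⟨⟨h6, h3⟩, h4, h2⟩
  · rintro ⟨⟨h1, h2⟩, h3, h4⟩
    have hd₁ : 1 ≤ d₁ := by
      by_contra h0
      push Not at h0
      have : d₁ = 0 := by omega
      rw [this, Nat.cast_zero] at h1
      exact absurd h1 (not_lt.2 hxσ)
    exact ⟨⟨hd₁, h4⟩, h2, h3, hd₀, h1⟩

/-! ### The double sum over `(d₀, d₁)` is `≪ 1 / log x` -/

/-- **The double sum of the main term.**  For `q₁ ≥ 1`, `Δ ≠ 0`, `D = |Δ|`, Siegel–Walfisz-strength
constants `C₁, C₂` (tails of `Σ_{(m,q)=1} μ(m)/m`, `Σ μ(m) log m/m` with exponent `6`), `σ > 0`, real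
`θ, η`, a natural `x ≥ 3` with `2D ≤ x^σ`, `D ≤ x^{σ/2}`, and box sides `B₀ ≤ x²`, `B₁`:
`|Σ_{d₀ ≤ B₀} Σ_{d₁ ≤ B₁} (μ(d₀) log d₀/d₀) [gcd(d₀,q₀)=1] [window] T(d₀,d₁)| ≤ K (2/σ)^6 3^5 / log x`,
`T(d₀,d₁) = [gcd(d₁,q₁)=1][gcd(d₀,d₁) ∣ Δ] μ(d₁) log d₁ gcd(d₀,d₁)/d₁`,
`K = τ(D)(C₁ log D + C₂) 4^{ω(q₁)}`. [folklore] -/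
theorem abs_doubleSum_le (q₀ : ℕ) {q₁ : ℕ} (hq₁ : 0 < q₁) {Δ : ℤ} (hΔ : Δ ≠ 0) {C₁ C₂ : ℝ}
    (hC₁0 : 0 ≤ C₁) (hC₂0 : 0 ≤ C₂)
    (hC₁ : ∀ q : ℕ, q ≠ 0 → ∀ A W : ℝ, 2 ≤ A → A ≤ W →
      |∑ n ∈ (Ioc ⌊A⌋₊ ⌊W⌋₊).filter (fun n : ℕ => n.Coprime q), (μ n : ℝ) / n| ≤
        C₁ * (4 : ℝ) ^ q.primeFactors.card / Real.log A ^ (6 : ℝ))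
    (hC₂ : ∀ q : ℕ, q ≠ 0 → ∀ A W : ℝ, 2 ≤ A → A ≤ W →
      |∑ n ∈ (Ioc ⌊A⌋₊ ⌊W⌋₊).filter (fun n : ℕ => n.Coprime q), (μ n : ℝ) * Real.log n / n| ≤
        C₂ * (4 : ℝ) ^ q.primeFactors.card / Real.log A ^ (6 : ℝ))
    {σ : ℝ} (hσ : 0 < σ) (θ η : ℝ) {x : ℕ} (hx₃ : 3 ≤ x)
    (hx₁ : 2 * (Δ.natAbs : ℝ) ≤ (x : ℝ) ^ σ) (hx₂ : (Δ.natAbs : ℝ) ≤ (x : ℝ) ^ (σ / 2))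
    {B₀ : ℕ} (hB0 : (B₀ : ℝ) ≤ (x : ℝ) ^ 2) (B₁ : ℕ) :
    |∑ d₀ ∈ Finset.Icc 1 B₀, ∑ d₁ ∈ Finset.Icc 1 B₁,
        (μ d₀ : ℝ) * Real.log d₀ / d₀ * ((if Nat.Coprime d₀ q₀ then (1 : ℝ) else 0) *
          (if (x : ℝ) ^ (1 - η) < (d₀ : ℝ) * d₁ ∧ (d₀ : ℝ) * d₁ ≤ (x : ℝ) ^ (1 + θ) ∧
              (x : ℝ) ^ σ < (d₀ : ℝ) ∧ (x : ℝ) ^ σ < (d₁ : ℝ) then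
            (if Nat.Coprime d₁ q₁ ∧ ((Nat.gcd d₀ d₁ : ℕ) : ℤ) ∣ Δ then
              (μ d₁ : ℝ) * Real.log d₁ * ((Nat.gcd d₀ d₁ : ℝ) / d₁) else 0) else 0))| ≤
      (Δ.natAbs.divisors.card : ℝ) * (C₁ * Real.log Δ.natAbs + C₂) *
        (4 : ℝ) ^ q₁.primeFactors.card * (2 / σ) ^ (6 : ℝ) * 3 ^ 5 / Real.log x := by
  set D : ℕ := Δ.natAbs with hDdef
  have hD : 0 < D := Int.natAbs_pos.2 hΔ
  have hDpos : (0 : ℝ) < D := by exact_mod_cast hD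
  have hD1 : (1 : ℝ) ≤ D := by exact_mod_cast hD
  set K : ℝ := (D.divisors.card : ℝ) * (C₁ * Real.log D + C₂) * (4 : ℝ) ^ q₁.primeFactors.card
    with hKdef
  have hK0 : 0 ≤ K := by
    rw [hKdef]
    have : 0 ≤ Real.log D := Real.log_nonneg hD1
    positivity
  have hx3 : (3 : ℝ) ≤ x := by exact_mod_cast hx₃
  have hx0 : (0 : ℝ) < x := by linarith
  have hlogx : 1 < Real.log x := by
    have := Real.exp_one_lt_d9
    rw [Real.lt_log_iff_exp_lt hx0]; linarith
  have hxσ : 0 ≤ (x : ℝ) ^ σ := Real.rpow_nonneg hx0.le σ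
  have hx1θ : 0 ≤ (x : ℝ) ^ (1 + θ) := Real.rpow_nonneg hx0.le _
  -- Step 2: for each `d₀`, the `d₁`-sum is an inner sum over an interval
  have hinner : ∀ d₀ ∈ Finset.Icc 1 B₀,
      |∑ d₁ ∈ Finset.Icc 1 B₁, (μ d₀ : ℝ) * Real.log d₀ / d₀ *
        ((if Nat.Coprime d₀ q₀ then (1 : ℝ) else 0) *
          (if (x : ℝ) ^ (1 - η) < (d₀ : ℝ) * d₁ ∧ (d₀ : ℝ) * d₁ ≤ (x : ℝ) ^ (1 + θ) ∧
              (x : ℝ) ^ σ < (d₀ : ℝ) ∧ (x : ℝ) ^ σ < (d₁ : ℝ) then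
            (if Nat.Coprime d₁ q₁ ∧ ((Nat.gcd d₀ d₁ : ℕ) : ℤ) ∣ Δ then
              (μ d₁ : ℝ) * Real.log d₁ * ((Nat.gcd d₀ d₁ : ℝ) / d₁) else 0) else 0))| ≤
          Real.log B₀ / d₀ * (K * (4 : ℝ) ^ d₀.primeFactors.card /
            ((σ / 2) * Real.log x) ^ (6 : ℝ)) := by
    intro d₀ hd₀
    rw [Finset.mem_Icc] at hd₀
    have hd₀pos : 0 < d₀ := hd₀.1
    have hd₀R : (0 : ℝ) < d₀ := by exact_mod_cast hd₀pos
    rw [← Finset.mul_sum, ← Finset.mul_sum, abs_mul, abs_mul]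
    -- `|μ(d₀) log d₀ / d₀| ≤ log B₀ / d₀`
    have hw : |(μ d₀ : ℝ) * Real.log d₀ / d₀| ≤ Real.log B₀ / d₀ := by
      rw [abs_div, abs_of_pos hd₀R]
      refine div_le_div_of_nonneg_right ?_ hd₀R.le
      rw [abs_mul]
      have h1 : |(μ d₀ : ℝ)| ≤ 1 := by exact_mod_cast ArithmeticFunction.abs_moebius_le_one
      have h2 : 0 ≤ Real.log d₀ := Real.log_nonneg (by exact_mod_cast hd₀pos)
      have h3 : Real.log d₀ ≤ Real.log B₀ :=
        Real.log_le_log hd₀R (by exact_mod_cast hd₀.2)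
      rw [abs_of_nonneg h2]
      nlinarith
    have hind : |(if Nat.Coprime d₀ q₀ then (1 : ℝ) else 0)| ≤ 1 := by
      split_ifs <;> simp
    -- the window sum
    have hwin : |∑ d₁ ∈ Finset.Icc 1 B₁,
        (if (x : ℝ) ^ (1 - η) < (d₀ : ℝ) * d₁ ∧ (d₀ : ℝ) * d₁ ≤ (x : ℝ) ^ (1 + θ) ∧
            (x : ℝ) ^ σ < (d₀ : ℝ) ∧ (x : ℝ) ^ σ < (d₁ : ℝ) then
          (if Nat.Coprime d₁ q₁ ∧ ((Nat.gcd d₀ d₁ : ℕ) : ℤ) ∣ Δ then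
              (μ d₁ : ℝ) * Real.log d₁ * ((Nat.gcd d₀ d₁ : ℝ) / d₁) else 0) else 0)| ≤
        K * (4 : ℝ) ^ d₀.primeFactors.card / ((σ / 2) * Real.log x) ^ (6 : ℝ) := by
      by_cases hσd₀ : (x : ℝ) ^ σ < d₀
      · rw [← Finset.sum_filter, filter_window_eq hxσ hx1θ hσd₀]
        set A : ℝ := max ((x : ℝ) ^ σ) ((x : ℝ) ^ (1 - η) / d₀) with hAdef
        have hA : 2 * (Δ.natAbs : ℝ) ≤ A := hx₁.trans (le_max_left _ _)
        have h := abs_inner_le hq₁ hΔ hC₁0 hC₂0 hC₁ hC₂ hd₀pos hA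
          (min ⌊(x : ℝ) ^ (1 + θ) / d₀⌋₊ B₁)
        refine h.trans ?_
        -- compare the logarithms: `log(A/D) ≥ (σ/2) log x`
        have hlogAD : (σ / 2) * Real.log x ≤ Real.log (A / Δ.natAbs) := by
          have hAσ : (x : ℝ) ^ σ / D ≤ A / D :=
            div_le_div_of_nonneg_right (le_max_left _ _) hDpos.le
          have hpos : 0 < (x : ℝ) ^ σ / D := by
            have : (0 : ℝ) < (x : ℝ) ^ σ := Real.rpow_pos_of_pos hx0 σ
            positivity
          calc (σ / 2) * Real.log x = Real.log ((x : ℝ) ^ σ) - Real.log ((x : ℝ) ^ (σ / 2)) := by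
                rw [Real.log_rpow hx0, Real.log_rpow hx0]; ring
            _ ≤ Real.log ((x : ℝ) ^ σ) - Real.log D := by
                have := Real.log_le_log hDpos hx₂; linarith
            _ = Real.log ((x : ℝ) ^ σ / D) := by
                rw [Real.log_div (Real.rpow_pos_of_pos hx0 σ).ne' hDpos.ne']
            _ ≤ Real.log (A / Δ.natAbs) := Real.log_le_log hpos hAσ
        have hσlog : 0 < (σ / 2) * Real.log x := by positivity
        have hpow : ((σ / 2) * Real.log x) ^ (6 : ℝ) ≤ Real.log (A / Δ.natAbs) ^ (6 : ℝ) :=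
          Real.rpow_le_rpow hσlog.le hlogAD (by norm_num)
        have hpowpos : 0 < ((σ / 2) * Real.log x) ^ (6 : ℝ) := Real.rpow_pos_of_pos hσlog _
        rw [hKdef]
        rw [div_le_div_iff₀ (lt_of_lt_of_le hpowpos hpow) hpowpos]
        have hnum : 0 ≤ (Δ.natAbs.divisors.card : ℝ) * (C₁ * Real.log Δ.natAbs + C₂) *
            (4 : ℝ) ^ q₁.primeFactors.card * (4 : ℝ) ^ d₀.primeFactors.card := by
          have : 0 ≤ Real.log (Δ.natAbs : ℝ) := Real.log_nonneg hD1
          positivity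
        calc (Δ.natAbs.divisors.card : ℝ) * (C₁ * Real.log Δ.natAbs + C₂) *
              (4 : ℝ) ^ q₁.primeFactors.card * (4 : ℝ) ^ d₀.primeFactors.card *
              ((σ / 2) * Real.log x) ^ (6 : ℝ)
            ≤ (Δ.natAbs.divisors.card : ℝ) * (C₁ * Real.log Δ.natAbs + C₂) *
              (4 : ℝ) ^ q₁.primeFactors.card * (4 : ℝ) ^ d₀.primeFactors.card *
              Real.log (A / Δ.natAbs) ^ (6 : ℝ) := mul_le_mul_of_nonneg_left hpow hnum
          _ = _ := by ring
      · have hzero : ∑ d₁ ∈ Finset.Icc 1 B₁,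
            (if (x : ℝ) ^ (1 - η) < (d₀ : ℝ) * d₁ ∧ (d₀ : ℝ) * d₁ ≤ (x : ℝ) ^ (1 + θ) ∧
              (x : ℝ) ^ σ < (d₀ : ℝ) ∧ (x : ℝ) ^ σ < (d₁ : ℝ) then
            (if Nat.Coprime d₁ q₁ ∧ ((Nat.gcd d₀ d₁ : ℕ) : ℤ) ∣ Δ then
              (μ d₁ : ℝ) * Real.log d₁ * ((Nat.gcd d₀ d₁ : ℝ) / d₁) else 0) else 0) = 0 := by
          refine Finset.sum_eq_zero fun d₁ _ => ?_
          rw [if_neg]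
          rintro ⟨-, -, h, -⟩
          exact hσd₀ h
        rw [hzero, abs_zero]
        have : 0 < (σ / 2) * Real.log x := by positivity
        positivity
    have hlogB : 0 ≤ Real.log B₀ / d₀ := by
      refine div_nonneg (Real.log_nonneg ?_) hd₀R.le
      exact_mod_cast (show 1 ≤ B₀ from hd₀.1.trans hd₀.2)
    calc |(μ d₀ : ℝ) * Real.log d₀ / d₀| * (|(if Nat.Coprime d₀ q₀ then (1 : ℝ) else 0)| * |_|)
        ≤ (Real.log B₀ / d₀) * (1 * (K * (4 : ℝ) ^ d₀.primeFactors.card /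
            ((σ / 2) * Real.log x) ^ (6 : ℝ))) := by
          refine mul_le_mul hw (mul_le_mul hind hwin (abs_nonneg _) zero_le_one)
            (by positivity) hlogB
      _ = _ := by ring
  -- Step 3: sum over `d₀`
  refine (Finset.abs_sum_le_sum_abs _ _).trans ?_
  refine (Finset.sum_le_sum hinner).trans ?_
  have hσlog : 0 < (σ / 2) * Real.log x := by positivity
  have hpowpos : 0 < ((σ / 2) * Real.log x) ^ (6 : ℝ) := Real.rpow_pos_of_pos hσlog _
  have hrw : ∑ d₀ ∈ Finset.Icc 1 B₀, Real.log B₀ / d₀ *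
      (K * (4 : ℝ) ^ d₀.primeFactors.card / ((σ / 2) * Real.log x) ^ (6 : ℝ)) =
      Real.log B₀ * K / ((σ / 2) * Real.log x) ^ (6 : ℝ) *
        ∑ d₀ ∈ Finset.Icc 1 B₀, (4 : ℝ) ^ d₀.primeFactors.card / d₀ := by
    rw [Finset.mul_sum]
    refine Finset.sum_congr rfl fun d₀ _ => ?_
    ring
  rw [hrw]
  have hlogB : Real.log B₀ ≤ 2 * Real.log x := by
    rcases Nat.eq_zero_or_pos B₀ with h0 | hpos
    · rw [h0, Nat.cast_zero, Real.log_zero]; positivity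
    · calc Real.log B₀ ≤ Real.log ((x : ℝ) ^ 2) :=
          Real.log_le_log (by exact_mod_cast hpos) hB0
        _ = 2 * Real.log x := by
          rw [show (x : ℝ) ^ 2 = (x : ℝ) ^ (2 : ℝ) by norm_cast, Real.log_rpow hx0]
  have hlogB0 : 0 ≤ Real.log B₀ := by
    rcases Nat.eq_zero_or_pos B₀ with h0 | hpos
    · rw [h0, Nat.cast_zero, Real.log_zero]
    · exact Real.log_nonneg (by exact_mod_cast hpos)
  have hsum4 := MoebiusCoprimeTail.sum_four_pow_card_primeFactors_div_le B₀
  have hsum4' : ∑ d₀ ∈ Finset.Icc 1 B₀, (4 : ℝ) ^ d₀.primeFactors.card / d₀ ≤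
      (3 * Real.log x) ^ 4 := by
    refine hsum4.trans ?_
    have : 1 + Real.log B₀ ≤ 3 * Real.log x := by linarith
    exact pow_le_pow_left₀ (by linarith) this 4
  have hsum0 : 0 ≤ ∑ d₀ ∈ Finset.Icc 1 B₀, (4 : ℝ) ^ d₀.primeFactors.card / d₀ :=
    Finset.sum_nonneg fun _ _ => by positivity
  -- `(σ/2 · log x)^6 = (σ/2)^6 (log x)^6`
  have hpow6 : ((σ / 2) * Real.log x) ^ (6 : ℝ) = (σ / 2) ^ (6 : ℝ) * Real.log x ^ 6 := by
    rw [Real.mul_rpow (by positivity) (by positivity)]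
    congr 1
    rw [show (6 : ℝ) = ((6 : ℕ) : ℝ) by norm_num, Real.rpow_natCast]
  have hσ6 : 0 < (σ / 2) ^ (6 : ℝ) := Real.rpow_pos_of_pos (by positivity) _
  have hinv : (2 / σ) ^ (6 : ℝ) = ((σ / 2) ^ (6 : ℝ))⁻¹ := by
    rw [← Real.inv_rpow (by positivity)]
    congr 1
    rw [inv_div]
  have hl : Real.log x ≠ 0 := by positivity
  calc Real.log B₀ * K / ((σ / 2) * Real.log x) ^ (6 : ℝ) *
        ∑ d₀ ∈ Finset.Icc 1 B₀, (4 : ℝ) ^ d₀.primeFactors.card / d₀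
      ≤ (2 * Real.log x) * K / ((σ / 2) * Real.log x) ^ (6 : ℝ) * (3 * Real.log x) ^ 4 := by
        refine mul_le_mul ?_ hsum4' hsum0 (by positivity)
        exact div_le_div_of_nonneg_right (mul_le_mul_of_nonneg_right hlogB hK0) hpowpos.le
    _ = (2 * 3 ^ 4) * (K * ((σ / 2) ^ (6 : ℝ))⁻¹) * (Real.log x)⁻¹ := by
        rw [hpow6]
        field_simp
    _ ≤ (3 ^ 5) * (K * ((σ / 2) ^ (6 : ℝ))⁻¹) * (Real.log x)⁻¹ := by
        have h0 : 0 ≤ (K * ((σ / 2) ^ (6 : ℝ))⁻¹) * (Real.log x)⁻¹ := by positivity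
        nlinarith
    _ = K * (2 / σ) ^ (6 : ℝ) * 3 ^ 5 / Real.log x := by
        rw [hinv]
        field_simp
    _ = _ := by rw [hKdef]

end Literature.NumberTheory.Sieve.LinearPairMoebius
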